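import Mathlib
import HarnessLib
import Summits.RiemannHypothesis.RiemannHypothesis.Theses.MayerPairing

/-!
# RiemannHypothesis / MayerPairing — the canary `GaussMeasureCalibration` (item 1474)

Route `RiemannHypothesis/MayerPairing`, item stmt-RiemannHypothesis-1474: the route's inlined
eigenvalue predicate, specialised to `s = 1`, `μ = 1`, is witnessed by the Gauss density
`f(z) = 1/(z+1)` (Chang–Mayer 2001, Prop. 4.1(i): `L_1` has the leading eigenvalue `1` with
eigenfunction `1/(z+1)`, the density of the Gauss measure up to the factor `1/log 2`). With
`δ = 1/2`: `f` is holomorphic on `Re z > -1/2`, `f 1 = 1/2 ≠ 0`,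
`f z - f (z+1) = 1/((z+1)(z+2)) = (z+1)^{-2} f(1/(z+1))`, and the normalisation expression
`f x - f 0 (x+1)^{1-2}/(2-1)` vanishes identically for `x > -1`. Candidate proofs by the route
refuters (evidence `Proof_MayerPairing_GaussMeasureCalibration.lean`, `Canary_MP.lean` on the item)
established this against the built route module; this file lands it.

* `mayerPairing_gaussMeasureCalibration : GaussMeasureCalibration`.
-/

namespace Summit.RiemannHypothesis.RiemannHypothesis.Theorems

open Filter Topology
open Summit.RiemannHypothesis.RiemannHypothesis.Theses.MayerPairing

/-- **The canary (item stmt-RiemannHypothesis-1474).** At `s = 1` the Gauss density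
`f(z) = 1/(z+1)` witnesses the route's inlined eigenvalue predicate with `μ = 1` (`δ = 1/2`).
[cite: ChangMayer2001, Prop. 4.1(i)] -/
theorem mayerPairing_gaussMeasureCalibration : GaussMeasureCalibration := by
  refine ⟨fun z => 1 / (z + 1), 1 / 2, by norm_num, ?_, ⟨1, by simp, by norm_num⟩, ?_, ?_⟩
  · -- holomorphy on `Re z > -1/2` (the pole `z = -1` is excluded)
    refine DifferentiableOn.div (differentiableOn_const 1) (differentiableOn_id.add_const 1) ?_
    intro z hz h0
    have hz' : -(1 / 2 : ℝ) < z.re := hz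
    have : (z + 1).re = 0 := by rw [h0]; simp
    simp at this
    linarith
  · -- the three-term equation with `μ = 1`, `s = 1`
    intro z hz
    have hz' : -(1 / 2 : ℝ) < z.re := hz
    have h1 : z + 1 ≠ 0 := by
      intro h0
      have : (z + 1).re = 0 := by rw [h0]; simp
      simp at this
      linarith
    have h2 : z + 1 + 1 ≠ 0 := by
      intro h0
      have : (z + 1 + 1).re = 0 := by rw [h0]; simp
      simp at this
      linarith
    have h2' : (2 : ℂ) + z ≠ 0 := by
      intro h0; exact h2 (by linear_combination h0)
    have h2'' : z + 2 ≠ 0 := by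
      intro h0; exact h2 (by linear_combination h0)
    have h3 : 1 + (z + 1) ≠ 0 := by
      intro h0; exact h2 (by linear_combination h0)
    have hpow : (z + 1) ^ (-(2 * (1 : ℂ))) = ((z + 1) ^ 2)⁻¹ := by
      rw [mul_one, Complex.cpow_neg, Complex.cpow_ofNat]
    rw [hpow, one_mul]
    show 1 / (z + 1) - 1 / (z + 1 + 1) = ((z + 1) ^ 2)⁻¹ * (1 / (1 / (z + 1) + 1))
    rw [div_add_one h1, one_div_div]
    field_simp
    ring
  · -- the normalisation: the expression vanishes identically for `x ≥ 0`
    apply tendsto_const_nhds.congr'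
    filter_upwards [eventually_ge_atTop (0 : ℝ)] with x hx
    have hx1 : (x : ℂ) + 1 ≠ 0 := by
      intro h0
      have : ((x : ℂ) + 1).re = 0 := by rw [h0]; simp
      simp at this
      linarith
    have hpow : ((x : ℂ) + 1) ^ (1 - 2 * (1 : ℂ)) = ((x : ℂ) + 1)⁻¹ := by
      rw [show (1 : ℂ) - 2 * 1 = -1 by norm_num, Complex.cpow_neg_one]
    rw [hpow]
    show (0 : ℂ) = 1 * (1 / ((x : ℂ) + 1)) - 1 / (0 + 1) * ((x : ℂ) + 1)⁻¹ / (2 * 1 - 1)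
    field_simp
    ring
end Summit.RiemannHypothesis.RiemannHypothesis.Theorems
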